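import Summits.ResolutionOfSingularities.ResolutionOfSingularities.Theorems.WeightedInvariantELadderTwoStage
import Summits.ResolutionOfSingularities.ResolutionOfSingularities.Theorems.WeightedInvariantKWildHomDrop
import Summits.ResolutionOfSingularities.ResolutionOfSingularities.Theorems.WeightedInvariantELadderTwoBase
import Summits.ResolutionOfSingularities.ResolutionOfSingularities.Theorems.WeightedInvariantELadderAssemblyMeasure
import HarnessLib

/-!
# SPEC (registrar res-L1-w43-plan-1 g12, E2-CENSUS v0 §5 (Δ1)): THE HOMOGENEOUS-DROP RUNG `PRungGrHomLE d p ι J` /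
# `KeyRungGrHomLE d p` and the E2 targets over it (`E2CentreH`, `E2InvSuccH`)

RULING #8 (CHAIN w43 v4.24) weakened the P3 reading of (c9′)≤3 to the successor primes that the e = 2 consumer actually
reads: the `t`-HOMOGENEOUS primes `𝔫` of the cobordant algebra (res-type-060's `WeightedDropHom`, p540275).  The E2 census
(registrar, `L/res-L1-w43-plan-1/E2-CENSUS-v0.md`) confirms that `E2InvSucc` consumes (c9′) only there.  This module types the
weakened clause (c9′-hom)≤d, the rung `PRungHomLE` / graded rung `PRungGrHomLE` / ∃-closure `KeyRungGrHomLE`, the seams from the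
rungs of record, and the E2 targets with the graded-hom rung as hypothesis (bodies of `E2Centre` / `E2InvSucc` verbatim, named
`E2CentreBody` / `E2InvSuccBody`).  Skeleton v3.11 registers `stub_keyRungGrHomLE_three`, `stub_e2_centre_h`, `stub_e2_inv_succ_h`.
[OURS · candidate objects of the line; nothing here is a statement of Hironaka 2017 ([claim: Hironaka2017, status: under-review]);
AI planning, weaker than expert review.]
-/

noncomputable section

set_option linter.dupNamespace false

open CategoryTheory AlgebraicGeometry TopologicalSpace IsLocalRing
open Literature.AlgebraicGeometry.Resolution
open Summit.ResolutionOfSingularities.ResolutionOfSingularities.Theorems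

namespace Summit.ResolutionOfSingularities.ResolutionOfSingularities.Cruxes.HypersurfaceCentreConstruction.LocalEngine

/-- (c9′-hom)≤d: `CanonicalGameClauseLE d p ι J` with its (drop) conjunct replaced by res-type-060's `WeightedDropHom`
(drop demanded at `t`-homogeneous successor primes only).  [OURS · candidate clause · registrar SPEC (Δ1)] -/
def CanonicalGameClauseHomLE (d p : ℕ) (ι : (R : Type) → [CommRing R] → R → Ordinal.{0})
    (J : (R : Type) → [CommRing R] → R → ℕ → Ideal R) : Prop :=
  ∀ (k₀ : Type) [Field k₀] [CharP k₀ p] [PerfectField k₀]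
    (S : Type) [CommRing S] [Algebra k₀ S] [Algebra.EssFiniteType k₀ S] [IsRegularLocalRing S]
    (f : S), ringKrullDim S ≤ d → f ≠ 0 → f ∈ (maximalIdeal S) ^ 2 →
    ∃ (P : Ideal S), P.IsPrime ∧ IsRegularLocalRing (S ⧸ P) ∧ f ∈ P ∧
      (∀ (𝔭 : Ideal S) [𝔭.IsPrime], f ∈ 𝔭 →
        (ι (Localization.AtPrime 𝔭) (algebraMap S (Localization.AtPrime 𝔭) f) = ι S f ↔ P ≤ 𝔭)) ∧
      (∀ (𝔭 : Ideal S) [𝔭.IsPrime], f ∈ 𝔭 → P ≤ 𝔭 → ∀ m : ℕ,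
        J (Localization.AtPrime 𝔭) (algebraMap S (Localization.AtPrime 𝔭) f) m =
          (J S f m).map (algebraMap S (Localization.AtPrime 𝔭))) ∧
      ∃ (n : ℕ) (u : Fin n → S) (w : Fin n → ℕ),
        Ideal.span (Set.range u) = maximalIdeal S ∧ (maximalIdeal S).spanFinrank = n ∧ (∃ i, 0 < w i) ∧
        Ideal.span {x | ∃ i, 0 < w i ∧ x = u i} = P ∧
        (∀ m : ℕ, weightedMonomialIdeal u w m = J S f m) ∧
        (∀ (Q : Ideal S) [Q.IsPrime], P ≤ Q →
          algebraMap S (Localization.AtPrime Q) f ∈ (maximalIdeal (Localization.AtPrime Q)) ^ 2) ∧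
        WeightedDropHom ι S f P u w

/-- Seam: (c9′)≤d ⇒ (c9′-hom)≤d. [OURS · seam] -/
theorem canonicalGameClauseHomLE_of_LE {d p : ℕ} {ι : (R : Type) → [CommRing R] → R → Ordinal.{0}}
    {J : (R : Type) → [CommRing R] → R → ℕ → Ideal R} (h : CanonicalGameClauseLE d p ι J) :
    CanonicalGameClauseHomLE d p ι J := by
  intro k₀ _ _ _ S _ _ _ _ f hd hf0 hf2
  obtain ⟨P, hP, hreg, hfP, hstr, hJ, n, u, w, hspan, hrk, hpos, hPu, hJuw, hsing, hdrop⟩ :=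
    h k₀ S f hd hf0 hf2
  exact ⟨P, hP, hreg, hfP, hstr, hJ, n, u, w, hspan, hrk, hpos, hPu, hJuw, hsing,
    fun 𝔫 _ _ hT hPn hv a g hfac hndvd hmem => hdrop 𝔫 hT hPn hv a g hfac hndvd hmem⟩

/-- The HOM rung in the door setting at Krull dimension `≤ d`: `PRungLE d p ι J` with (c9′)≤d replaced by (c9′-hom)≤d.
[OURS · candidate · registrar SPEC (Δ1)] -/
def PRungHomLE (d p : ℕ) (ι : (R : Type) → [CommRing R] → R → Ordinal.{0})
    (J : (R : Type) → [CommRing R] → R → ℕ → Ideal R) : Prop :=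
  IotaIsoInvariant ι ∧ IotaGenerizationMonotoneLE d p ι ∧ IotaUpperSemicontinuousLE d p ι ∧
  IotaTorusFactorMonotoneLE d p ι ∧ JIsoInvariant J ∧ IotaJEssSmoothCompatibleLE d ι J ∧ CanonicalGameClauseHomLE d p ι J ∧
  JOpenPresentationForallSingLE d p ι J ∧ IotaUnitInvariant ι ∧ JUnitInvariant J

/-- The GRADED HOM rung: `PRungHomLE` AND (c8-gr)≤d,p. [OURS · candidate · registrar SPEC (Δ1)] -/
def PRungGrHomLE (d p : ℕ) (ι : (R : Type) → [CommRing R] → R → Ordinal.{0})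
    (J : (R : Type) → [CommRing R] → R → ℕ → Ideal R) : Prop :=
  PRungHomLE d p ι J ∧ IotaUpperSemicontinuousGradedLE d p ι

/-- ∃-closure of the graded HOM rung (skeleton v3.11's P3 stub: `stub_keyRungGrHomLE_three : ∀ p, p.Prime → KeyRungGrHomLE 3 p`).
[OURS · candidate · registrar SPEC (Δ1)] -/
def KeyRungGrHomLE (d p : ℕ) : Prop :=
  ∃ (ι : (R : Type) → [CommRing R] → R → Ordinal.{0}) (J : (R : Type) → [CommRing R] → R → ℕ → Ideal R),
    PRungGrHomLE d p ι J

/-- Seam: `PRungLE ⇒ PRungHomLE`. [OURS · seam] -/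
theorem pRungHomLE_of_pRungLE {d p : ℕ} {ι : (R : Type) → [CommRing R] → R → Ordinal.{0}}
    {J : (R : Type) → [CommRing R] → R → ℕ → Ideal R} (h : PRungLE d p ι J) : PRungHomLE d p ι J := by
  obtain ⟨h1, h2, h3, h4, h5, h6, h7, h8, h9, h10⟩ := h
  exact ⟨h1, h2, h3, h4, h5, h6, canonicalGameClauseHomLE_of_LE h7, h8, h9, h10⟩

/-- Seam: `PRungGrLE ⇒ PRungGrHomLE`. [OURS · seam] -/
theorem pRungGrHomLE_of_pRungGrLE {d p : ℕ} {ι : (R : Type) → [CommRing R] → R → Ordinal.{0}}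
    {J : (R : Type) → [CommRing R] → R → ℕ → Ideal R} (h : PRungGrLE d p ι J) : PRungGrHomLE d p ι J :=
  ⟨pRungHomLE_of_pRungLE h.1, h.2⟩

/-- Seam: `KeyRungGrLE ⇒ KeyRungGrHomLE`. [OURS · seam] -/
theorem keyRungGrHomLE_of_keyRungGrLE {d p : ℕ} (h : KeyRungGrLE d p) : KeyRungGrHomLE d p := by
  obtain ⟨ι, J, h⟩ := h
  exact ⟨ι, J, pRungGrHomLE_of_pRungGrLE h⟩

/-- Seam: the KEY gives the graded HOM rung at every `d`. [OURS · seam] -/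
theorem keyRungGrHomLE_of_eft4S (d p : ℕ) (h : LocalWeightedDropEFT4S p) : KeyRungGrHomLE d p :=
  keyRungGrHomLE_of_keyRungGrLE (keyRungGrLE_of_eft4S d p h)

/-- Seam: `d = 2` holds (from the landed P2 rung). [OURS · seam] -/
theorem keyRungGrHomLE_two : ∀ p : ℕ, p.Prime → KeyRungGrHomLE 2 p := fun p hp =>
  keyRungGrHomLE_of_keyRungGrLE (keyRungGrLE_two p hp)

/-- Concluder seam for a NAMED pair. [OURS · seam] -/
theorem keyRungGrHomLE_three_of_pair (ι : (R : Type) → [CommRing R] → R → Ordinal.{0})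
    (J : (R : Type) → [CommRing R] → R → ℕ → Ideal R) (p : ℕ) (h : PRungGrHomLE 3 p ι J) : KeyRungGrHomLE 3 p :=
  ⟨ι, J, h⟩

/-! ## The E2 targets over the graded HOM rung -/

open Summit.ResolutionOfSingularities.ResolutionOfSingularities.Theorems.ELadderOne

/-- The body of `E2Centre p ι J` behind its rung hypothesis (verbatim), named. [OURS · candidate] -/
def E2CentreBody (p : ℕ) (ι : (R : Type) → [CommRing R] → R → Ordinal.{0})
    (J : (R : Type) → [CommRing R] → R → ℕ → Ideal R) : Prop :=
  ∀ ⦃k : Type⦄ [Field k] [CharP k p] [PerfectField k] (S : Stage k), S.InvDim₂ → ¬ Scheme.IsRegular S.X →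
    ∃ R : ReesAlgebraData S.Y, IsAdmissibleCentre S.f S.i.ker R ∧ S.i (genericPoint S.X) ∉ R.support ∧
      S.IsCanonicalCentre₂ ι J R

/-- The body of `E2InvSucc p ι J` behind its rung hypothesis (verbatim), named. [OURS · candidate] -/
def E2InvSuccBody (p : ℕ) (ι : (R : Type) → [CommRing R] → R → Ordinal.{0})
    (J : (R : Type) → [CommRing R] → R → ℕ → Ideal R) : Prop :=
  ∀ ⦃k : Type⦄ [Field k] [CharP k p] [PerfectField k] (S : Stage k), S.InvDim₂ → ¬ Scheme.IsRegular S.X →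
    ∀ (R : ReesAlgebraData S.Y), IsAdmissibleCentre S.f S.i.ker R → S.i (genericPoint S.X) ∉ R.support →
      S.IsCanonicalCentre₂ ι J R →
    ∀ (R' : ReesFiltration S.Y), R'.ideal = R.piece →
    ∀ [Smooth (R'.πPlus ≫ S.f)] [IsSeparated (R'.πPlus ≫ S.f)] [QuasiCompact (R'.πPlus ≫ S.f)]
      [IsIntegral (R'.strictTransformPlus S.i.ker).subscheme]
      (hlp' : IsLocallyPrincipal (R'.strictTransformPlus S.i.ker).subschemeι.ker)
      (V' : Scheme.{0}) (ρ : V' ⟶ S.V) [IsIntegral V'] [IsProper ρ]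
      (q' : (R'.strictTransformPlus S.i.ker).subscheme ⟶ V')
      (hq' : q' ≫ ρ ≫ S.g = (R'.strictTransformPlus S.i.ker).subschemeι ≫ R'.πPlus ≫ S.f)
      (𝒜' : GradedAtlas (S.j + 1) (R'.πPlus ≫ S.f) (R'.strictTransformPlus S.i.ker).subschemeι q'),
      (⟨R'.plus, R'.πPlus ≫ S.f, (R'.strictTransformPlus S.i.ker).subscheme,
          (R'.strictTransformPlus S.i.ker).subschemeι, hlp', V', q', ρ ≫ S.g, hq', S.j + 1, 𝒜'⟩ : Stage k).InvDim₂ ∧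
        (⟨R'.plus, R'.πPlus ≫ S.f, (R'.strictTransformPlus S.i.ker).subscheme,
          (R'.strictTransformPlus S.i.ker).subschemeι, hlp', V', q', ρ ≫ S.g, hq', S.j + 1, 𝒜'⟩ : Stage k).mu₂ ι <
          S.mu₂ ι

/-- `E2Centre` unfolds to «graded rung ⇒ body» (definitional record). [OURS · seam] -/
theorem e2Centre_iff (p : ℕ) (ι : (R : Type) → [CommRing R] → R → Ordinal.{0})
    (J : (R : Type) → [CommRing R] → R → ℕ → Ideal R) : E2Centre p ι J ↔ (PRungGrLE 3 p ι J → E2CentreBody p ι J) :=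
  Iff.rfl

/-- `E2InvSucc` unfolds to «graded rung ⇒ body» (definitional record). [OURS · seam] -/
theorem e2InvSucc_iff (p : ℕ) (ι : (R : Type) → [CommRing R] → R → Ordinal.{0})
    (J : (R : Type) → [CommRing R] → R → ℕ → Ideal R) : E2InvSucc p ι J ↔ (PRungGrLE 3 p ι J → E2InvSuccBody p ι J) :=
  Iff.rfl

/-- E2 CENTRE over the graded HOM rung (skeleton v3.11's `stub_e2_centre_h`; STRONGER than `E2Centre`). [OURS · candidate] -/
def E2CentreH (p : ℕ) (ι : (R : Type) → [CommRing R] → R → Ordinal.{0})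
    (J : (R : Type) → [CommRing R] → R → ℕ → Ideal R) : Prop :=
  PRungGrHomLE 3 p ι J → E2CentreBody p ι J

/-- E2 SUCCESSOR over the graded HOM rung (skeleton v3.11's `stub_e2_inv_succ_h`; STRONGER than `E2InvSucc`). [OURS · candidate] -/
def E2InvSuccH (p : ℕ) (ι : (R : Type) → [CommRing R] → R → Ordinal.{0})
    (J : (R : Type) → [CommRing R] → R → ℕ → Ideal R) : Prop :=
  PRungGrHomLE 3 p ι J → E2InvSuccBody p ι J

/-- Seam: `E2CentreH ⇒ E2Centre` (closes the v3.10 stub `stub_e2_centre` by name from the v3.11 stub). [OURS · seam] -/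
theorem e2Centre_of_h {p : ℕ} {ι : (R : Type) → [CommRing R] → R → Ordinal.{0}}
    {J : (R : Type) → [CommRing R] → R → ℕ → Ideal R} (h : E2CentreH p ι J) : E2Centre p ι J :=
  fun hP => h (pRungGrHomLE_of_pRungGrLE hP)

/-- Seam: `E2InvSuccH ⇒ E2InvSucc`. [OURS · seam] -/
theorem e2InvSucc_of_h {p : ℕ} {ι : (R : Type) → [CommRing R] → R → Ordinal.{0}}
    {J : (R : Type) → [CommRing R] → R → ℕ → Ideal R} (h : E2InvSuccH p ι J) : E2InvSucc p ι J :=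
  fun hP => h (pRungGrHomLE_of_pRungGrLE hP)

/-- SHAPE OF THE v3.11 ASSEMBLY (statement only; proof in the skeleton = `ELadder.ladder_assembly_measure` (p541146) with
`Inv := InvDim₂`, `μ := mu₂ ι`, `Good := IsCanonicalCentre₂ ι J`, `ELadderOne.e2_base` for the start, `KeyRungGrHomLE 3 p` to pick the pair).
[OURS · candidate] -/
def E2AssemblyShapeH (p : ℕ) : Prop :=
  (∀ ι J, E2CentreH p ι J) → (∀ ι J, E2InvSuccH p ι J) → KeyRungGrHomLE 3 p → AdmissiblyResolvableDim p 2

/-- **The v3.11 assembly shape HOLDS** (no stub): the tree's abstract ladder `ELadder.ladder_assembly_measure` (p541146) with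
`W := Ordinal.{0}`, `Inv := InvDim₂`, `μ := mu₂ ι`, `Good := IsCanonicalCentre₂ ι J`, started by `ELadderOne.e2_base` (p540098).
[OURS · proved seam] -/
theorem e2AssemblyShapeH_holds (p : ℕ) : E2AssemblyShapeH p := by
  intro hc hs hgr
  obtain ⟨ι, J, hP⟩ := hgr
  intro k _ _ _ P hdim _
  obtain ⟨S, hInv, _, hSP⟩ := ELadderOne.e2_base p P hdim
  rw [← hSP]
  exact ELadder.ladder_assembly_measure (W := Ordinal.{0}) Stage.InvDim₂ (Stage.mu₂ ι)
    (fun S R => Stage.IsCanonicalCentre₂ ι J S R) (fun S => hc ι J hP S) (fun S => hs ι J hP S) S hInv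

end Summit.ResolutionOfSingularities.ResolutionOfSingularities.Cruxes.HypersurfaceCentreConstruction.LocalEngine

end
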